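import Literature.Analysis.FluidPDE.NSLerayHopf
import Literature.Analysis.FluidPDE.NSHopfGalerkinExistence
import Literature.Analysis.FluidPDE.NSHopfGalerkinLimit
import HarnessLib

/-!
# Hopf's existence theorem on `𝕋³` — discharge of the named fact `NS.hopf_existence_torus`
  (**ns.S06**)

Trunk: FluidKinetic. `Literature.Analysis.FluidPDE.NSLerayHopf` records Hopf's global existence
theorem for Leray–Hopf weak solutions of the forced Navier–Stokes system on the flat torus as the
named fact `Literature.Analysis.FluidPDE.hopf_existence_torus`. This sibling proof file **proves** it by the
Fourier–Galerkin method along the printed proof (Hopf 1951, §§2–4; Robinson–Rodrigo–Sadowski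
2016, Thm. 4.4 (Hopf) with Thm. 4.6, Cor. 4.7 and Thm. 4.11; Constantin–Foias 1988, Ch. 8,
Theorem (Leray) for the forced problem): the two halves of the Galerkin decomposition of
`NSHopfGalerkin` —

* `NS.hopf_galerkin_scheme_exists_holds` (`NSHopfGalerkinExistence`: smoothed forces, the global
  Galerkin ODE in the real divergence-free Fourier coefficients with its tested identity and
  energy identity), and
* `NS.hopf_galerkin_limit_holds` (`NSHopfLimit`, `NSHopfEnergy`, `NSHopfGalerkinLimit`:
  compactness, the limit field, Friedrichs' inequality, energy inequalities, weak continuity,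
  the energy class, and the weak form of the equations) —

are composed by the assembly `NS.hopf_existence_torus_of_galerkin` (RRS 2016, Thm. 4.4: scheme,
then limit). *Imports (module hygiene, 2026-08-16, refactor item `defn-NSLerayHopfOpenFacts`):*
this file imports the hub `NSLerayHopf` explicitly, because `NSHopfGalerkin` no longer does (it
needs nothing from it; the hub carries the trunk's open problems, which must stay out of the
module cone of the Galerkin tools); for the same reason the three-line assembly
`hopf_existence_torus_of_galerkin : hopf_galerkin_scheme_exists → hopf_galerkin_limit →
hopf_existence_torus`, formerly in `NSHopfGalerkin`, lives here (moved verbatim).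

(The sibling `NSLerayHopfProofs` is reserved for the Escauriaza–Seregin–Šverák decomposition and
carries named facts of its own, so the discharge lives in this separate theorem-only file.)

## References

* E. Hopf, *Über die Anfangswertaufgabe für die hydrodynamischen Grundgleichungen*, Math. Nachr.
  4 (1951), 213–231, §§2–4.
* J. C. Robinson, J. L. Rodrigo, W. Sadowski, *The three-dimensional Navier–Stokes equations*
  (CUP 2016), Thm. 4.4, Thm. 4.6, Cor. 4.7, Thm. 4.11.
* P. Constantin, C. Foias, *Navier–Stokes Equations* (Chicago 1988), Ch. 8, Theorem (Leray).
-/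

namespace Literature.Analysis.FluidPDE

/-- **Hopf's existence theorem on `𝕋³`, proved** (Hopf 1951, §§2–4: global weak solutions by
the Galerkin method; Robinson–Rodrigo–Sadowski 2016, Thm. 4.4 with Thm. 4.6 (strong energy
inequality, after Ladyzhenskaya 1969) and Cor. 4.7 (strong attainment of the datum);
Constantin–Foias 1988, Ch. 8, Theorem (Leray), forced problem): for `ν > 0`, a weakly
divergence-free datum `u₀ ∈ L²(𝕋³)` and a space–time measurable force with
`f ∈ L²((0, T) × 𝕋³)` for every `T > 0`, there is a global Leray–Hopf weak solution.
Discharges the named fact `NS.hopf_existence_torus`: the Galerkin approximations exist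
(`hopf_galerkin_scheme_exists_holds`; RRS 2016, Thm. 4.4, Steps 1–2) and every Galerkin scheme has
a Leray–Hopf limit (`hopf_galerkin_limit_holds`; RRS 2016, Thm. 4.4, Steps 3–4, Thm. 4.6,
Cor. 4.7); real proof (composition). [cite: Hopf1951, §§2–4] [cite: RobinsonRodrigoSadowski2016, Thm. 4.4, Thm. 4.6, Cor. 4.7, Thm. 4.11] -/
theorem hopf_existence_torus_holds : hopf_existence_torus := by
  intro ν hν u₀ hu₀ hdiv f hf hf₂
  obtain ⟨N, F, U, hS⟩ := hopf_galerkin_scheme_exists_holds ν hν u₀ hu₀ hdiv f hf hf₂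
  exact hopf_galerkin_limit_holds ν hν u₀ hu₀ hdiv f hf hf₂ N F U hS

/-- **Assembly of Hopf's existence theorem on `𝕋³`** from its two halves: the Galerkin
approximations exist (`hopf_galerkin_scheme_exists`; RRS 2016, Thm. 4.4, Steps 1–2) and every
Galerkin scheme has a Leray–Hopf limit (`hopf_galerkin_limit`; RRS 2016, Thm. 4.4, Steps 3–4,
Thm. 4.6, Cor. 4.7). Real proof (composition). Moved here verbatim from `NSHopfGalerkin.lean`
(module hygiene, 2026-08-16: that file no longer imports the hub declaring the conclusion). [cite: RobinsonRodrigoSadowski2016, Thm. 4.4] -/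
theorem hopf_existence_torus_of_galerkin (h₁ : hopf_galerkin_scheme_exists)
    (h₂ : hopf_galerkin_limit) : hopf_existence_torus := by
  intro ν hν u₀ hu₀ hdiv f hf hf₂
  obtain ⟨N, F, U, hS⟩ := h₁ ν hν u₀ hu₀ hdiv f hf hf₂
  exact h₂ ν hν u₀ hu₀ hdiv f hf hf₂ N F U hS

end Literature.Analysis.FluidPDE
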